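import Mathlib

/-!
# Two-sided trapping of the decaying solution of a Riccati equation with large repulsion

Consider, on a half-line `[x₀, ∞)` (`x₀ > 0`), a `C¹` function `η` with

  `y(x) · η′(x) = η(x)² + A(x) · η(x) − F(x)`,   `0 < y(x) ≤ κ x`,   `A(x) ≥ A₀ > 0`,

and `η(x) → 0` as `x → +∞` (the *recessive* or decaying solution; for the normalised Riccati variables
`η_k = −y W_k − λ_k` of a recessive Crum chain this is the normalisation `x·W_k → −λ_k`, with
`A = 2λ_k − 1 − ε ≥ 2`, and for the seed `A = 2ℓ + 1 − ε`).  Because the linear part is REPULSIVE for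
increasing `x`, the decaying solution is trapped by the forcing:

* `recessive_le` : if `F ≤ A₀ Q` on `[x₀, ∞)` with `Q ≥ 0`, then `η ≤ Q` on `[x₀, ∞)`;
* `recessive_ge` : if `F ≥ −A₀ P` on `[x₀, ∞)` with `0 ≤ P < A₀/4`, then `η ≥ −2P` on `[x₀, ∞)`.

(Applied on `[x, ∞)` these give `−2 sup_{x′ ≥ x} F⁻/A₀ ≤ η(x) ≤ sup_{x′ ≥ x} F⁺/A₀`; in particular
`η ≥ 0` where `F ≥ 0`.)  Proofs: barrier (fencing) arguments — above `Q` the solution would increase at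
rate `≥ δ/y ≥ δ/(κx)` and diverge logarithmically; below `−2P` it would stay below a negative level —
both contradicting `η → 0`. [folklore]
-/

noncomputable section

namespace Literature.Analysis.ODE

open Set Filter Topology

/-- **Upper trap.**  The decaying solution of `y η′ = η² + A η − F` (with `0 < y ≤ κ x`,
`A ≥ A₀ > 0`) satisfies `η ≤ Q` as soon as `F ≤ A₀ Q` (`Q ≥ 0`) on the half-line. [folklore] -/
theorem recessive_le {η η' y A F : ℝ → ℝ} {x₀ A₀ κ Q : ℝ} (hx₀ : 0 < x₀) (hκ : 0 < κ)
    (hA₀ : 0 < A₀) (hQ : 0 ≤ Q)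
    (hderiv : ∀ x, x₀ ≤ x → HasDerivAt η (η' x) x)
    (hode : ∀ x, x₀ ≤ x → y x * η' x = η x ^ 2 + A x * η x - F x)
    (hy : ∀ x, x₀ ≤ x → 0 < y x) (hyle : ∀ x, x₀ ≤ x → y x ≤ κ * x)
    (hA : ∀ x, x₀ ≤ x → A₀ ≤ A x) (hF : ∀ x, x₀ ≤ x → F x ≤ A₀ * Q)
    (hlim : Tendsto η atTop (𝓝 0)) :
    ∀ x, x₀ ≤ x → η x ≤ Q := by
  intro x₁ hx₁
  by_contra hcon
  rw [not_le] at hcon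
  set μ := (η x₁ - Q) / 2 with hμ
  have hμpos : 0 < μ := by rw [hμ]; linarith
  set δ := A₀ * μ with hδ
  have hδpos : 0 < δ := mul_pos hA₀ hμpos
  have hx₁pos : 0 < x₁ := lt_of_lt_of_le hx₀ hx₁
  -- barrier from below: L t = η x₁ − μ + (δ/κ) (log t − log x₁)
  set L : ℝ → ℝ := fun t => η x₁ - μ + δ / (2 * κ) * (Real.log t - Real.log x₁) with hL
  have hLderiv : ∀ t, 0 < t → HasDerivAt L (δ / (2 * κ) * t⁻¹) t := by
    intro t ht
    have h := ((Real.hasDerivAt_log ht.ne').sub_const (Real.log x₁)).const_mul (δ / (2 * κ))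
      |>.const_add (η x₁ - μ)
    simpa [hL] using h
  -- fencing on every [x₁, b]: L ≤ η
  have hfence : ∀ b, ∀ t ∈ Icc x₁ b, L t ≤ η t := by
    intro b t ht
    have hcontη : ContinuousOn η (Icc x₁ b) := fun s hs =>
      (hderiv s (le_trans hx₁ hs.1)).continuousAt.continuousWithinAt
    have hcontL : ContinuousOn L (Icc x₁ b) := fun s hs =>
      (hLderiv s (lt_of_lt_of_le hx₁pos hs.1)).continuousAt.continuousWithinAt
    refine image_le_of_deriv_right_lt_deriv_boundary' (f := L) (B := η) hcontL
      (fun s hs => (hLderiv s (lt_of_lt_of_le hx₁pos hs.1)).hasDerivWithinAt) ?_ hcontη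
      (fun s hs => (hderiv s (le_trans hx₁ hs.1)).hasDerivWithinAt) ?_ ht
    · -- L x₁ = η x₁ − μ ≤ η x₁
      have hLx₁ : L x₁ = η x₁ - μ := by simp [hL]
      rw [hLx₁]
      linarith
    · intro s hs hLs
      have hs₀ : x₀ ≤ s := le_trans hx₁ hs.1
      have hspos : 0 < s := lt_of_lt_of_le hx₁pos hs.1
      have hlog : 0 ≤ Real.log s - Real.log x₁ := by
        have := Real.log_le_log hx₁pos hs.1
        linarith
      have hηs : η x₁ - μ ≤ η s := by
        rw [← hLs]
        simp only [hL]
        have : 0 ≤ δ / (2 * κ) * (Real.log s - Real.log x₁) :=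
          mul_nonneg (div_nonneg hδpos.le (by linarith)) hlog
        linarith
      have hηQ : Q + μ ≤ η s := by rw [hμ] at hηs ⊢; linarith
      have hηpos : 0 ≤ η s := by linarith
      have hrhs : δ ≤ η s ^ 2 + A s * η s - F s := by
        have h1 : A₀ * η s ≤ A s * η s := mul_le_mul_of_nonneg_right (hA s hs₀) hηpos
        have h2 := hF s hs₀
        have h3 : 0 ≤ η s ^ 2 := sq_nonneg _
        have h4 : A₀ * (Q + μ) ≤ A₀ * η s := mul_le_mul_of_nonneg_left hηQ hA₀.le
        rw [hδ]
        nlinarith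
      rw [← hode s hs₀] at hrhs
      have hys := hy s hs₀
      have hyle' := hyle s hs₀
      have hη'pos : 0 ≤ η' s := by
        by_contra hneg
        rw [not_le] at hneg
        have : y s * η' s < 0 := mul_neg_of_pos_of_neg hys hneg
        linarith
      have hη' : δ / (κ * s) ≤ η' s := by
        rw [div_le_iff₀ (mul_pos hκ hspos)]
        have : y s * η' s ≤ κ * s * η' s := mul_le_mul_of_nonneg_right hyle' hη'pos
        linarith
      have hlt : δ / (2 * κ) * s⁻¹ < δ / (κ * s) := by
        have hks : 0 < κ * s := mul_pos hκ hspos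
        have e : δ / (2 * κ) * s⁻¹ = (δ / 2) / (κ * s) := by
          field_simp
        rw [e, div_lt_div_iff_of_pos_right hks]
        linarith
      linarith
  -- contradiction with η → 0: η t ≥ L t → ∞
  have hev : ∀ᶠ t in atTop, |η t| < μ := by
    have := (Metric.tendsto_nhds.1 hlim) μ hμpos
    simpa [Real.dist_eq] using this
  obtain ⟨T, hT⟩ :=
    (hev.and (eventually_ge_atTop
      (max x₁ (Real.exp (Real.log x₁ + 2 * κ / δ * (3 * μ)))))).exists
  obtain ⟨hηT, hTge⟩ := hT
  have hTx₁ : x₁ ≤ T := le_trans (le_max_left _ _) hTge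
  have hlogT : Real.log x₁ + 2 * κ / δ * (3 * μ) ≤ Real.log T := by
    have h := le_trans (le_max_right _ _) hTge
    have := Real.log_le_log (Real.exp_pos _) h
    rwa [Real.log_exp] at this
  have hLT := hfence T T ⟨hTx₁, le_rfl⟩
  simp only [hL] at hLT
  have hgrow : 3 * μ ≤ δ / (2 * κ) * (Real.log T - Real.log x₁) := by
    have hk : 2 * κ / δ * (3 * μ) ≤ Real.log T - Real.log x₁ := by linarith
    have := mul_le_mul_of_nonneg_left hk (div_nonneg hδpos.le (by linarith : (0:ℝ) ≤ 2 * κ))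
    have e : δ / (2 * κ) * (2 * κ / δ * (3 * μ)) = 3 * μ := by
      field_simp
    linarith [e]
  have habs := (abs_lt.1 hηT).2
  have : η x₁ = Q + 2 * μ := by rw [hμ]; ring
  linarith

/-- **Lower trap.**  The decaying solution of `y η′ = η² + A η − F` (with `0 < y`, `A ≥ A₀ > 0`)
satisfies `η ≥ −2P` as soon as `F ≥ −A₀ P` on the half-line, `0 ≤ P < A₀/4`.  (No growth
condition on `y` is needed here: below `−2P` the solution would stay below a negative level.)
[folklore] -/
theorem recessive_ge {η η' y A F : ℝ → ℝ} {x₀ A₀ P : ℝ}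
    (hA₀ : 0 < A₀) (hP : 0 ≤ P) (hP4 : P < A₀ / 4)
    (hderiv : ∀ x, x₀ ≤ x → HasDerivAt η (η' x) x)
    (hode : ∀ x, x₀ ≤ x → y x * η' x = η x ^ 2 + A x * η x - F x)
    (hy : ∀ x, x₀ ≤ x → 0 < y x)
    (hA : ∀ x, x₀ ≤ x → A₀ ≤ A x) (hF : ∀ x, x₀ ≤ x → -(A₀ * P) ≤ F x)
    (hlim : Tendsto η atTop (𝓝 0)) :
    ∀ x, x₀ ≤ x → -(2 * P) ≤ η x := by
  intro x₁ hx₁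
  by_contra hcon
  rw [not_le] at hcon
  set d := min ((-(2 * P) - η x₁) / 2) ((A₀ - 4 * P) / 8) with hd
  have hd1 : d ≤ (-(2 * P) - η x₁) / 2 := min_le_left _ _
  have hd2 : d ≤ (A₀ - 4 * P) / 8 := min_le_right _ _
  have hdpos : 0 < d := by
    rw [hd]; refine lt_min ?_ ?_ <;> linarith
  set lev := -(2 * P) - d with hlev
  have hlev1 : η x₁ < lev := by rw [hlev]; linarith
  have hlev2 : lev < 0 := by rw [hlev]; linarith
  have hlevA : 0 < A₀ + lev := by rw [hlev]; linarith
  -- fencing: η ≤ lev on every [x₁, b]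
  have hfence : ∀ b, ∀ t ∈ Icc x₁ b, η t ≤ lev := by
    intro b t ht
    have hcontη : ContinuousOn η (Icc x₁ b) := fun s hs =>
      (hderiv s (le_trans hx₁ hs.1)).continuousAt.continuousWithinAt
    refine image_le_of_deriv_right_lt_deriv_boundary' (f := η) (B := fun _ => lev) hcontη
      (fun s hs => (hderiv s (le_trans hx₁ hs.1)).hasDerivWithinAt) hlev1.le continuousOn_const
      (fun s _ => (hasDerivAt_const s lev).hasDerivWithinAt) ?_ ht
    intro s hs hηs
    have hs₀ : x₀ ≤ s := le_trans hx₁ hs.1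
    have h1 : η s ^ 2 + A s * η s = η s * (A s + η s) := by ring
    have hAs := hA s hs₀
    have hneg : η s * (A s + η s) ≤ lev * (A₀ + lev) := by
      rw [hηs]
      have : A₀ + lev ≤ A s + lev := by linarith
      exact mul_le_mul_of_nonpos_left this hlev2.le
    have hval : lev * (A₀ + lev) + A₀ * P < 0 := by
      rw [hlev]
      nlinarith
    have hrhs : y s * η' s < 0 := by
      rw [hode s hs₀, h1]
      have := hF s hs₀
      linarith
    have hys := hy s hs₀
    by_contra hge
    rw [not_lt] at hge
    have : 0 ≤ y s * η' s := mul_nonneg hys.le hge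
    linarith
  have hev : ∀ᶠ t in atTop, |η t| < -lev := by
    have := (Metric.tendsto_nhds.1 hlim) (-lev) (by linarith)
    simpa [Real.dist_eq] using this
  obtain ⟨T, hηT, hTge⟩ := (hev.and (eventually_ge_atTop x₁)).exists
  have hle := hfence T T ⟨hTge, le_rfl⟩
  have := (abs_lt.1 hηT).1
  linarith

end Literature.Analysis.ODE
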